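import Summits.CriticalPhenomena.PercolationContinuityZ3.Theorems.PercNearOneGluingNoHeavyLowerTailGeometricMomentCIL
import HarnessLib

/-!
# `NoHeavyLowerTail` (stmt-CriticalPhenomena-4575) — the geometric-moment CIL is needed only in the NEAR-ONE REGIME,
# and the registered stub `stub_geometricMomentCIL` closes the crux

Support file (lead gen 4; `--supports stmt-CriticalPhenomena-4575`).  No definitions, no named facts, no sorries.
Notation as in `…GeometricMomentCIL.lean`: `L(v) = Σ_{j≥1} v^j P(N=j)`, `R_a(v) = Σ_{j≥0} v^j P(|π(a)|=j)`.

* `noHeavyLowerTail_of_geometricMomentCIL_nearOne` — the WEAKEST socket of the family: fix ANY `τ₀ > 0` and `C ≥ 0`; it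
  suffices that every graph IN THE REGIME `{P(a ↮ a') ≤ τ₀ ∀ a, a' ∈ A, P(o ↮ A) ≤ τ₀}` admits, for every `v ∈ (0,1]`, a relay
  `a ∈ A` with `L(v) ≤ C · (R_a(v) + P(o ↮ A))`.  (The one-cut modulus reduction only ever evaluates the hypothesis at budgets
  `τ ≤ τ₀`; so a prover may assume pairwise reliability and a reliable observer — a giant relay block exists with probability
  `≥ 1 − 2τ₀`, etc. — and may spend the observer budget additively.)
* `noHeavyLowerTail_of_stub_geometricMomentCIL` — the registered stub `stub_geometricMomentCIL` of stmt-4575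
  (`∃ C ≥ 0 ∧ GM-CIL(C)`, all graphs) implies the crux (unpack and apply `noHeavyLowerTail_of_geometricMomentCIL`).
-/

noncomputable section

namespace Summit.CriticalPhenomena.PercolationContinuityZ3.Theorems

open MeasureTheory Set Literature.Probability.LatticeModels Literature.Probability.Percolation
open Summit.CriticalPhenomena.PercolationContinuityZ3.Theses.PercNearOneGluing
open scoped Classical BigOperators

open GeomMomentCIL in
/-- **Geometric-moment CIL in the near-one regime, with any constant and the observer budget ⇒ `NoHeavyLowerTail`.**
[this work] -/
theorem noHeavyLowerTail_of_geometricMomentCIL_nearOne (C τ₀ : ℝ) (hC : 0 ≤ C) (hτ₀ : 0 < τ₀)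
    (hGM : ∀ (n : ℕ) (w : Sym2 (Fin n) → unitInterval) (A : Finset (Fin n)) (o : Fin n) (v : ℝ),
      0 < v → v ≤ 1 → A.Nonempty → o ∉ A →
      (∀ a ∈ A, ∀ a' ∈ A, (prodBernoulli w).real (openConn a a' : Set (BondConfig (Fin n)))ᶜ ≤ τ₀) →
      (prodBernoulli w).real (⋃ a ∈ A, (openConn o a : Set (BondConfig (Fin n))))ᶜ ≤ τ₀ →
      ∃ a ∈ A,
        ∑ j ∈ Finset.Icc 1 A.card, v ^ j * (prodBernoulli w).real {ω : BondConfig (Fin n) |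
            (A.filter fun x => ω ∈ openConn o x).card = j} ≤
          C * (∑ j ∈ Finset.range (A.card + 1), v ^ j * (prodBernoulli w).real {ω : BondConfig (Fin n) |
            (A.filter fun x => ω ∈ openConn a x).card = j} +
            (prodBernoulli w).real (⋃ a ∈ A, (openConn o a : Set (BondConfig (Fin n))))ᶜ)) :
    Summit.CriticalPhenomena.PercolationContinuityZ3.Theses.PercNearOneGluing.NoHeavyLowerTail := by
  refine noHeavyLowerTail_of_oneCut_modulus fun ε hε => ?_
  set C₁ : ℝ := max C 1 with hC₁def
  have hC₁1 : 1 ≤ C₁ := le_max_right _ _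
  have hC₁0 : 0 < C₁ := by linarith
  have hCC₁ : C ≤ C₁ := le_max_left _ _
  set s : ℝ := min 1 (ε / (4 * C₁)) with hsdef
  have hs1 : s ≤ 1 := min_le_left _ _
  have hsε : s ≤ ε / (4 * C₁) := min_le_right _ _
  have hs0 : 0 < s := lt_min one_pos (by positivity)
  have hC₁s : C₁ * s ≤ ε / 4 := by
    calc C₁ * s ≤ C₁ * (ε / (4 * C₁)) := mul_le_mul_of_nonneg_left hsε hC₁0.le
      _ = ε / 4 := by field_simp
  -- budget: as in the `_obs` version, capped by the regime bound `τ₀`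
  set τ₁ : ℝ := ε * s / (12 * C₁) with hτ₁def
  have hτ₁0 : 0 < τ₁ := by positivity
  set τ : ℝ := min τ₀ τ₁ with hτdef
  have hτ0 : 0 < τ := lt_min hτ₀ hτ₁0
  have hττ₀ : τ ≤ τ₀ := min_le_left _ _
  have hττ₁ : τ ≤ τ₁ := min_le_right _ _
  have hτε : 2 * τ ≤ ε := by
    have h1 : ε * s ≤ ε * (6 * C₁) := by nlinarith
    have h2 : 2 * τ₁ = ε * s / (6 * C₁) := by rw [hτ₁def]; ring
    have h3 : 2 * τ₁ ≤ ε := by rw [h2, div_le_iff₀ (by positivity)]; exact h1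
    linarith
  refine ⟨1 / 4, τ, by norm_num, hτ0, fun n w A o hpair hU => ?_⟩
  set μ := prodBernoulli w with hμ
  have hpair' : ∀ a ∈ A, ∀ a' ∈ A, μ.real (openConn a a' : Set (BondConfig (Fin n)))ᶜ ≤ τ := by
    intro a ha a' ha'
    by_cases h : a = a'
    · subst h; exact measureReal_compl_openConn_self_le w a hτ0.le
    · exact hpair a ha a' ha' h
  have hpair₀ : ∀ a ∈ A, ∀ a' ∈ A, μ.real (openConn a a' : Set (BondConfig (Fin n)))ᶜ ≤ τ₀ :=
    fun a ha a' ha' => (hpair' a ha a' ha').trans hττ₀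
  have hU₀ : μ.real (⋃ a ∈ A, (openConn o a : Set (BondConfig (Fin n))))ᶜ ≤ τ₀ := hU.trans hττ₀
  have hEN : ∑ a ∈ A, μ.real (openConn o a : Set (BondConfig (Fin n))) ≤ A.card := by
    calc ∑ a ∈ A, μ.real (openConn o a : Set (BondConfig (Fin n))) ≤ ∑ a ∈ A, (1 : ℝ) :=
          Finset.sum_le_sum fun a _ => measureReal_le_one
      _ = A.card := by simp
  set J : ℕ := A.card / 4 with hJdef
  set T : Set (BondConfig (Fin n)) := {ω : BondConfig (Fin n) |
      1 ≤ (A.filter fun x => ω ∈ openConn o x).card ∧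
        (A.filter fun x => ω ∈ openConn o x).card ≤ J} with hTdef
  have hsub : {ω : BondConfig (Fin n) | 1 ≤ (A.filter fun a => ω ∈ openConn o a).card ∧
        ((A.filter fun a => ω ∈ openConn o a).card : ℝ) <
          1 / 4 * (∑ a ∈ A, μ.real (openConn o a : Set (BondConfig (Fin n))))} ⊆ T := by
    intro ω hω
    simp only [Set.mem_setOf_eq] at hω
    refine ⟨hω.1, ?_⟩
    have hlt : ((A.filter fun a => ω ∈ openConn o a).card : ℝ) < 1 / 4 * (A.card : ℝ) :=
      lt_of_lt_of_le hω.2 (by nlinarith)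
    have h4 : (4 * (A.filter fun a => ω ∈ openConn o a).card : ℕ) < A.card := by
      have : (4 : ℝ) * ((A.filter fun a => ω ∈ openConn o a).card : ℝ) < (A.card : ℝ) := by linarith
      exact_mod_cast this
    rw [hJdef]; omega
  refine (measureReal_mono hsub (measure_ne_top _ _)).trans ?_
  by_cases hJ0 : J = 0
  · have hT : T = ∅ := by
      ext ω; simp only [hTdef, Set.mem_setOf_eq, Set.mem_empty_iff_false, iff_false, not_and, not_le]
      intro h1; omega
    rw [hT, measureReal_empty]; exact hε.le
  have hJ1 : 1 ≤ J := Nat.one_le_iff_ne_zero.2 hJ0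
  have hAcard : 4 ≤ A.card := by rw [hJdef] at hJ1; omega
  have hAne : A.Nonempty := Finset.card_pos.1 (by omega)
  by_cases ho : o ∈ A
  · have hT2 : T ⊆ {ω : BondConfig (Fin n) | 2 * (A.filter fun a' => ω ∈ openConn o a').card ≤ A.card} := by
      intro ω hω
      simp only [hTdef, Set.mem_setOf_eq] at hω ⊢
      rw [hJdef] at hω; omega
    calc μ.real T ≤ μ.real {ω : BondConfig (Fin n) |
          2 * (A.filter fun a' => ω ∈ openConn o a').card ≤ A.card} :=
          measureReal_mono hT2 (measure_ne_top _ _)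
      _ ≤ 2 * τ := smallBlock_le_two_mul w A o τ ho (hpair' o ho)
      _ ≤ ε := hτε
  set v : ℝ := s ^ ((J : ℝ)⁻¹) with hvdef
  have hv0 : 0 < v := Real.rpow_pos_of_pos hs0 _
  have hv1 : v ≤ 1 := Real.rpow_le_one hs0.le hs1 (inv_nonneg.2 (Nat.cast_nonneg J))
  have hvJ : v ^ J = s := Real.rpow_inv_natCast_pow hs0.le hJ0
  obtain ⟨a, ha, hle⟩ := hGM n w A o v hv0 hv1 hAne ho hpair₀ hU₀
  have hlow := pow_mul_window_le_momentSum μ (fun ω => (A.filter fun x => ω ∈ openConn o x).card)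
    v hv0.le hv1 J A.card (Nat.div_le_self _ _)
  set h : ℕ := A.card / 2 + 1 with hhdef
  have hup := momentSum_le_small_add_pow μ (fun ω => (A.filter fun x => ω ∈ openConn a x).card)
    v hv0.le hv1 A.card h
  have hsmall : μ.real {ω : BondConfig (Fin n) | (A.filter fun x => ω ∈ openConn a x).card < h} ≤ 2 * τ := by
    have heq : {ω : BondConfig (Fin n) | (A.filter fun x => ω ∈ openConn a x).card < h} =
        {ω : BondConfig (Fin n) | 2 * (A.filter fun a' => ω ∈ openConn a a').card ≤ A.card} := by
      ext ω; simp only [Set.mem_setOf_eq, hhdef]; omega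
    rw [heq]
    exact smallBlock_le_two_mul w A a τ ha (hpair' a ha)
  have hvh : v ^ h ≤ s * s := by
    have h2J : 2 * J ≤ h := by rw [hhdef, hJdef]; omega
    calc v ^ h ≤ v ^ (2 * J) := pow_le_pow_of_le_one hv0.le hv1 h2J
      _ = s * s := by rw [pow_mul', hvJ, sq]
  have hchain : s * μ.real T ≤ C * (2 * τ + s * s + τ) := by
    have e1 : v ^ J * μ.real T ≤ C * (μ.real {ω : BondConfig (Fin n) |
        (A.filter fun x => ω ∈ openConn a x).card < h} + v ^ h +
          μ.real (⋃ a ∈ A, (openConn o a : Set (BondConfig (Fin n))))ᶜ) := by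
      refine (hlow.trans hle).trans (mul_le_mul_of_nonneg_left ?_ hC)
      linarith [hup]
    rw [hvJ] at e1
    refine e1.trans (mul_le_mul_of_nonneg_left ?_ hC)
    linarith [hsmall, hvh, hU]
  have hkey : C * (2 * τ + s * s + τ) ≤ s * (ε / 2) := by
    have h3τ : 2 * τ₁ + τ₁ = ε * s / (4 * C₁) := by rw [hτ₁def]; ring
    have hb0 : 0 ≤ 2 * τ + s * s + τ := by positivity
    calc C * (2 * τ + s * s + τ) ≤ C₁ * (2 * τ + s * s + τ) := mul_le_mul_of_nonneg_right hCC₁ hb0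
      _ ≤ C₁ * ((2 * τ₁ + τ₁) + s * s) := by
          refine mul_le_mul_of_nonneg_left ?_ hC₁0.le; linarith
      _ = ε * s / 4 + (C₁ * s) * s := by rw [h3τ]; field_simp
      _ ≤ ε * s / 4 + (ε / 4) * s := by nlinarith [hC₁s, hs0.le]
      _ = s * (ε / 2) := by ring
  have hfin : μ.real T ≤ ε / 2 := le_of_mul_le_mul_left (hchain.trans hkey) hs0
  linarith

/-- **The registered stub `stub_geometricMomentCIL` of stmt-CriticalPhenomena-4575 closes the crux**: unpack the constant and
apply `noHeavyLowerTail_of_geometricMomentCIL`. [this work] -/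
theorem noHeavyLowerTail_of_stub_geometricMomentCIL
    (h : ∃ C : ℝ, 0 ≤ C ∧ ∀ (n : ℕ) (w : Sym2 (Fin n) → unitInterval) (A : Finset (Fin n)) (o : Fin n) (v : ℝ),
      0 < v → v ≤ 1 → A.Nonempty → o ∉ A → ∃ a ∈ A,
        (∑ j ∈ Finset.Icc 1 A.card, v ^ j * (Literature.Probability.LatticeModels.prodBernoulli w).real
          {ω : Literature.Probability.Percolation.BondConfig (Fin n) |
            (A.filter fun x => ω ∈ Literature.Probability.Percolation.openConn o x).card = j}) ≤
          C * ∑ j ∈ Finset.range (A.card + 1), v ^ j *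
            (Literature.Probability.LatticeModels.prodBernoulli w).real
              {ω : Literature.Probability.Percolation.BondConfig (Fin n) |
                (A.filter fun x => ω ∈ Literature.Probability.Percolation.openConn a x).card = j}) :
    Summit.CriticalPhenomena.PercolationContinuityZ3.Theses.PercNearOneGluing.NoHeavyLowerTail := by
  obtain ⟨C, hC, hGM⟩ := h
  exact noHeavyLowerTail_of_geometricMomentCIL C hC hGM
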